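import Summits.QuantumFields.YangMills.Theorems.HyperbolicRegulatorHyperbolicToTorusDefs

/-!
# Stub `stub_sphereLarge` of the line `no_admissible_complex` (crux `HyperbolicToTorus`, stmt-QuantumFields-15827)

Registered stub SPHERE LARGE of the skeleton `Cruxes/HyperbolicToTorus/Lines/no_admissible_complex.lean` (v3): in an
admissible complex at curvature scale `k ≥ 16` (`Rn := k/4 ≥ 4`), given flat `ℤ²`-charts with tracking at every flat
vertex, the first flat shell `{v ∈ V | dist v c = Rn + 1}` around the cone `c` of a cone frame `(c, x)` has at least
`Rn - 1` elements: `k / 4 ≤ sphereCard k V E σ τ c + 1`.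

Proof (folklore, pure combinatorics in one chart `φ := cV x` of radius `Rn` centred at `x`):
* anchors: tracking the geodesic `x ⟶ c` (length `Rn + 1`) for `Rn` steps gives a box point `P`, `‖P‖₁ ≤ Rn`, with
  `φ P` adjacent to `c`; tracking the geodesic `x ⟶ p` towards the deep point `p` of the frame for `Rn` steps gives a box
  point `Q`, `‖Q‖₁ ≤ Rn`, with `dist (φ Q) c ≥ 2 Rn + 1` (the geodesic `c ⟶ x ⟶ p` passes through `φ Q`);
* chart distance: box points at `ℓ¹`-distance `n` have images at graph distance `≤ n` (lattice neighbours are adjacent),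
  whence `‖P - Q‖₁ ≥ dist (φ P) (φ Q) ≥ 2 Rn`, so `P` and `Q` sit in opposite closed quadrants and one of
  `|P.2 - Q.2| ≤ Rn`, `|P.1 - Q.1| ≤ Rn` holds;
* rows (or columns, by the symmetry swapping the two coordinates): in every row `t` with `|t - P.2|, |t - Q.2| ≤ Rn - 1`
  the distance to `c` is `≤ Rn` at `(P.1, t)` and `≥ Rn + 2` at `(Q.1, t)` and changes by at most one per lattice step,
  so (discrete intermediate value theorem) it equals `Rn + 1` somewhere in the row; there are `2 Rn - 1 - |P.2 - Q.2| ≥ Rn - 1`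
  such rows, the points found are distinct box points, and the chart is injective on the box with values in `V`.
No published theorem is restated; references: the line file `Lines/no_admissible_complex.md` of the crux.
-/

set_option autoImplicit false

namespace Summit.QuantumFields.YangMills.Cruxes.HyperbolicToTorus.NoAdmissibleComplex

open Finset

namespace StubSphereLarge

/-- One lattice step from `a` towards `b ≠ a` inside the box of radius `R`: it stays in the box and decreases the
`ℓ¹`-distance to `b` by one. -/
theorem step_towards {R : ℤ} {a b : ℤ × ℤ} (ha : InBox R a) (hb : InBox R b) (hab : a ≠ b) :
    ∃ a' : ℤ × ℤ, UnitStep a a' ∧ InBox R a' ∧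
      |a'.1 - b.1| + |a'.2 - b.2| + 1 ≤ |a.1 - b.1| + |a.2 - b.2| := by
  obtain ⟨ha1, ha2⟩ := ha
  obtain ⟨hb1, hb2⟩ := hb
  rw [abs_le] at ha1 ha2 hb1 hb2
  rcases lt_trichotomy a.1 b.1 with h | h | h
  · refine ⟨(a.1 + 1, a.2), Or.inl rfl, ⟨abs_le.mpr ⟨by omega, by omega⟩, abs_le.mpr ha2⟩, ?_⟩
    show |a.1 + 1 - b.1| + |a.2 - b.2| + 1 ≤ |a.1 - b.1| + |a.2 - b.2|
    rw [abs_of_nonpos (by omega : a.1 + 1 - b.1 ≤ 0), abs_of_neg (by omega : a.1 - b.1 < 0)]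
    omega
  · rcases lt_trichotomy a.2 b.2 with h' | h' | h'
    · refine ⟨(a.1, a.2 + 1), Or.inr (Or.inr (Or.inl rfl)), ⟨abs_le.mpr ha1, abs_le.mpr ⟨by omega, by omega⟩⟩, ?_⟩
      show |a.1 - b.1| + |a.2 + 1 - b.2| + 1 ≤ |a.1 - b.1| + |a.2 - b.2|
      rw [abs_of_nonpos (by omega : a.2 + 1 - b.2 ≤ 0), abs_of_neg (by omega : a.2 - b.2 < 0)]
      omega
    · exact absurd (Prod.ext h h') hab
    · refine ⟨(a.1, a.2 - 1), Or.inr (Or.inr (Or.inr rfl)), ⟨abs_le.mpr ha1, abs_le.mpr ⟨by omega, by omega⟩⟩, ?_⟩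
      show |a.1 - b.1| + |a.2 - 1 - b.2| + 1 ≤ |a.1 - b.1| + |a.2 - b.2|
      rw [abs_of_nonneg (by omega : 0 ≤ a.2 - 1 - b.2), abs_of_pos (by omega : 0 < a.2 - b.2)]
      omega
  · refine ⟨(a.1 - 1, a.2), Or.inr (Or.inl rfl), ⟨abs_le.mpr ⟨by omega, by omega⟩, abs_le.mpr ha2⟩, ?_⟩
    show |a.1 - 1 - b.1| + |a.2 - b.2| + 1 ≤ |a.1 - b.1| + |a.2 - b.2|
    rw [abs_of_nonneg (by omega : 0 ≤ a.1 - 1 - b.1), abs_of_pos (by omega : 0 < a.1 - b.1)]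
    omega

/-- **Chart distance.** If lattice neighbours of the box are sent to adjacent vertices, then box points at
`ℓ¹`-distance `≤ n` are sent to reachable vertices at graph distance `≤ n` (induction on `n`, one lattice step towards
the target at a time, triangle inequality). -/
theorem chart_dist {Γ : SimpleGraph ℕ} {R : ℤ} {ψ : ℤ × ℤ → ℕ}
    (hadj : ∀ a b : ℤ × ℤ, InBox R a → InBox R b → UnitStep a b → Γ.Adj (ψ a) (ψ b)) (n : ℕ) :
    ∀ a b : ℤ × ℤ, InBox R a → InBox R b → |a.1 - b.1| + |a.2 - b.2| ≤ n →
      Γ.Reachable (ψ a) (ψ b) ∧ Γ.dist (ψ a) (ψ b) ≤ n := by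
  induction n with
  | zero =>
    intro a b _ _ hab
    have h1 := abs_cases (a.1 - b.1)
    have h2 := abs_cases (a.2 - b.2)
    obtain rfl : a = b := Prod.ext (by omega) (by omega)
    exact ⟨SimpleGraph.Reachable.refl _, by rw [SimpleGraph.dist_self]⟩
  | succ n ih =>
    intro a b ha hb hab
    by_cases heq : a = b
    · subst heq
      exact ⟨SimpleGraph.Reachable.refl _, by rw [SimpleGraph.dist_self]; exact Nat.zero_le _⟩
    obtain ⟨a', hst, ha', hle⟩ := step_towards ha hb heq
    have hadj' := hadj a a' ha ha' hst
    obtain ⟨hr, hd⟩ := ih a' b ha' hb (by push_cast at hab; omega)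
    refine ⟨hadj'.reachable.trans hr, ?_⟩
    have h1 : Γ.dist (ψ a) (ψ a') = 1 := SimpleGraph.dist_eq_one_iff_adj.mpr hadj'
    have := hadj'.reachable.dist_triangle_left (ψ b)
    omega

/-- Discrete intermediate value theorem: an `ℕ`-valued sequence with increments `≤ 1` that starts `≤ m` and ends
`≥ m` takes the value `m`. -/
theorem ivt (g : ℕ → ℕ) (m : ℕ) :
    ∀ n : ℕ, (∀ i : ℕ, i < n → g (i + 1) ≤ g i + 1) → g 0 ≤ m → m ≤ g n → ∃ i : ℕ, i ≤ n ∧ g i = m := by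
  intro n
  induction n with
  | zero =>
    intro _ h0 hn
    exact ⟨0, le_rfl, le_antisymm h0 hn⟩
  | succ n ih =>
    intro hst h0 hn
    by_cases h : m ≤ g n
    · obtain ⟨i, hi, hgi⟩ := ih (fun i hi => hst i (Nat.lt_succ_of_lt hi)) h0 h
      exact ⟨i, Nat.le_succ_of_le hi, hgi⟩
    · have := hst n (Nat.lt_succ_self n)
      exact ⟨n + 1, le_rfl, by omega⟩

/-- **Row crossing.** Walking along the row `t` of the chart from `(s₀, t)` in direction `d = ±1` for `n` steps inside
the box, the distance to `c` increases by at most one per step (consecutive images are adjacent); if it is `≤ m` at the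
start and `≥ m` at the end, it equals `m` somewhere on the way. -/
theorem row_hit {Γ : SimpleGraph ℕ} {R : ℤ} {ψ : ℤ × ℤ → ℕ}
    (hadj : ∀ a b : ℤ × ℤ, InBox R a → InBox R b → UnitStep a b → Γ.Adj (ψ a) (ψ b)) (c m : ℕ) (t s₀ d : ℤ)
    (hd : d = 1 ∨ d = -1) (ht : |t| ≤ R) (n : ℕ) (hbox : ∀ i : ℕ, i ≤ n → |s₀ + d * i| ≤ R)
    (h0 : Γ.dist (ψ (s₀, t)) c ≤ m) (hn : m ≤ Γ.dist (ψ (s₀ + d * n, t)) c) :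
    ∃ i : ℕ, i ≤ n ∧ Γ.dist (ψ (s₀ + d * i, t)) c = m := by
  refine ivt (fun i : ℕ => Γ.dist (ψ (s₀ + d * i, t)) c) m n ?_ (by simpa using h0) hn
  intro i hi
  have hst : UnitStep (s₀ + d * i, t) (s₀ + d * (i + 1 : ℕ), t) := by
    rcases hd with rfl | rfl
    · left
      show ((_, _) : ℤ × ℤ) = (_, _)
      congr 1
      push_cast
      ring
    · right; left
      show ((_, _) : ℤ × ℤ) = (_, _)
      congr 1
      push_cast
      ring
  have ha := hadj _ _ ⟨hbox i hi.le, ht⟩ ⟨hbox (i + 1) hi, ht⟩ hst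
  have h1 : Γ.dist (ψ (s₀ + d * (i + 1 : ℕ), t)) (ψ (s₀ + d * i, t)) = 1 :=
    SimpleGraph.dist_eq_one_iff_adj.mpr ha.symm
  have := ha.symm.reachable.dist_triangle_left c
  omega

/-- **Rows.** Abstract form of the count: `ψ` sends lattice neighbours of the box of radius `Rn` to adjacent vertices,
`P`, `Q` are points of `ℓ¹`-norm `≤ Rn` with `dist (ψ P) c ≤ 1`, `dist (ψ Q) c ≥ 2 Rn + 1`, second coordinates of
opposite weak signs and `|P.2 - Q.2| ≤ Rn`. Then at least `Rn - 1` box points are sent to vertices at distance exactly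
`Rn + 1` from `c`: one in each row `t` with `|t - P.2| ≤ Rn - 1`, `|t - Q.2| ≤ Rn - 1` (`row_hit` between `(P.1, t)`,
at distance `≤ Rn` by `chart_dist`, and `(Q.1, t)`, at distance `≥ Rn + 2`). -/
theorem rows_core {Γ : SimpleGraph ℕ} {Rn : ℕ} {ψ : ℤ × ℤ → ℕ}
    (hadj : ∀ a b : ℤ × ℤ, InBox Rn a → InBox Rn b → UnitStep a b → Γ.Adj (ψ a) (ψ b))
    (c : ℕ) (hRn : 1 ≤ Rn) (P Q : ℤ × ℤ) (hP : |P.1| + |P.2| ≤ Rn) (hQ : |Q.1| + |Q.2| ≤ Rn)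
    (hPc : Γ.dist (ψ P) c ≤ 1) (hQc : 2 * Rn + 1 ≤ Γ.dist (ψ Q) c)
    (hsgn : P.2 ≤ 0 ∧ 0 ≤ Q.2 ∨ Q.2 ≤ 0 ∧ 0 ≤ P.2) (hm : |P.2 - Q.2| ≤ Rn) :
    ∃ S : Finset (ℤ × ℤ), (∀ a ∈ S, InBox Rn a ∧ Γ.dist (ψ a) c = Rn + 1) ∧ Rn - 1 ≤ S.card := by
  have hbP : InBox Rn P := ⟨by have := abs_nonneg P.2; omega, by have := abs_nonneg P.1; omega⟩
  have hbQ : InBox Rn Q := ⟨by have := abs_nonneg Q.2; omega, by have := abs_nonneg Q.1; omega⟩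
  -- direction and number of steps from `P.1` to `Q.1`
  obtain ⟨d, n, hd, hn⟩ : ∃ (d : ℤ) (n : ℕ), (d = 1 ∨ d = -1) ∧ Q.1 = P.1 + d * n := by
    rcases le_total P.1 Q.1 with h | h
    · exact ⟨1, (Q.1 - P.1).toNat, Or.inl rfl, by omega⟩
    · exact ⟨-1, (P.1 - Q.1).toNat, Or.inr rfl, by omega⟩
  have hbox : ∀ i : ℕ, i ≤ n → |P.1 + d * i| ≤ Rn := by
    intro i hi
    have h1 := hbP.1
    have h2 := hbQ.1
    rw [abs_le] at h1 h2 ⊢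
    rcases hd with rfl | rfl <;> constructor <;> omega
  -- a crossing point in every admissible row
  have hrow : ∀ t : ℤ, |t - P.2| ≤ Rn - 1 → |t - Q.2| ≤ Rn - 1 →
      ∃ s : ℤ, InBox Rn (s, t) ∧ Γ.dist (ψ (s, t)) c = Rn + 1 := by
    intro t htP htQ
    rw [abs_le] at htP htQ
    have ht : |t| ≤ Rn := by
      rw [abs_le]
      constructor <;> omega
    have h0 : Γ.dist (ψ (P.1, t)) c ≤ Rn + 1 := by
      obtain ⟨hr, hdist⟩ := chart_dist hadj (Rn - 1) (P.1, t) P ⟨hbP.1, ht⟩ hbP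
        (by
          show |P.1 - P.1| + |t - P.2| ≤ ((Rn - 1 : ℕ) : ℤ)
          rw [sub_self, abs_zero, zero_add, abs_le]
          constructor <;> omega)
      have := hr.dist_triangle_left c
      omega
    have h1 : Rn + 1 ≤ Γ.dist (ψ (P.1 + d * n, t)) c := by
      rw [← hn]
      obtain ⟨hr, hdist⟩ := chart_dist hadj (Rn - 1) Q (Q.1, t) hbQ ⟨hbQ.1, ht⟩
        (by
          show |Q.1 - Q.1| + |Q.2 - t| ≤ ((Rn - 1 : ℕ) : ℤ)
          rw [sub_self, abs_zero, zero_add, abs_le]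
          constructor <;> omega)
      have := hr.dist_triangle_left c
      omega
    obtain ⟨i, hi, hdi⟩ := row_hit hadj c (Rn + 1) t P.1 d hd ht n hbox (by omega) h1
    exact ⟨P.1 + d * i, ⟨hbox i hi, ht⟩, hdi⟩
  choose! f hf using hrow
  refine ⟨(Finset.Icc (max P.2 Q.2 - (Rn - 1)) (min P.2 Q.2 + (Rn - 1))).image fun t => (f t, t), ?_, ?_⟩
  · intro a ha
    obtain ⟨t, ht, rfl⟩ := Finset.mem_image.mp ha
    rw [Finset.mem_Icc] at ht
    exact hf t (by rw [abs_le]; constructor <;> omega) (by rw [abs_le]; constructor <;> omega)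
  · rw [Finset.card_image_of_injective _ fun t t' h => (Prod.ext_iff.mp h).2, Int.card_Icc]
    have := abs_cases (P.2 - Q.2)
    omega

/-- The chart-adjacency hypothesis is symmetric under swapping the two coordinates of `ℤ²`. -/
theorem adj_swap {Γ : SimpleGraph ℕ} {R : ℤ} {ψ : ℤ × ℤ → ℕ}
    (hadj : ∀ a b : ℤ × ℤ, InBox R a → InBox R b → UnitStep a b → Γ.Adj (ψ a) (ψ b)) :
    ∀ a b : ℤ × ℤ, InBox R a → InBox R b → UnitStep a b → Γ.Adj (ψ a.swap) (ψ b.swap) := by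
  intro a b ha hb hs
  refine hadj a.swap b.swap ⟨ha.2, ha.1⟩ ⟨hb.2, hb.1⟩ ?_
  rcases hs with rfl | rfl | rfl | rfl
  · exact Or.inr (Or.inr (Or.inl rfl))
  · exact Or.inr (Or.inr (Or.inr rfl))
  · exact Or.inl rfl
  · exact Or.inr (Or.inl rfl)

/-- **Columns.** `rows_core` with the two coordinates swapped (applied to `ψ ∘ Prod.swap`): if the first coordinates
of `P`, `Q` have opposite weak signs and `|P.1 - Q.1| ≤ Rn`, at least `Rn - 1` box points (one per admissible column)
are sent to vertices at distance exactly `Rn + 1` from `c`. -/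
theorem cols_core {Γ : SimpleGraph ℕ} {Rn : ℕ} {ψ : ℤ × ℤ → ℕ}
    (hadj : ∀ a b : ℤ × ℤ, InBox Rn a → InBox Rn b → UnitStep a b → Γ.Adj (ψ a) (ψ b))
    (c : ℕ) (hRn : 1 ≤ Rn) (P Q : ℤ × ℤ) (hP : |P.1| + |P.2| ≤ Rn) (hQ : |Q.1| + |Q.2| ≤ Rn)
    (hPc : Γ.dist (ψ P) c ≤ 1) (hQc : 2 * Rn + 1 ≤ Γ.dist (ψ Q) c)
    (hsgn : P.1 ≤ 0 ∧ 0 ≤ Q.1 ∨ Q.1 ≤ 0 ∧ 0 ≤ P.1) (hm : |P.1 - Q.1| ≤ Rn) :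
    ∃ S : Finset (ℤ × ℤ), (∀ a ∈ S, InBox Rn a ∧ Γ.dist (ψ a) c = Rn + 1) ∧ Rn - 1 ≤ S.card := by
  obtain ⟨S, hS, hcard⟩ := rows_core (adj_swap hadj) c hRn P.swap Q.swap
    (by rw [Prod.fst_swap, Prod.snd_swap, add_comm]; exact hP)
    (by rw [Prod.fst_swap, Prod.snd_swap, add_comm]; exact hQ) hPc hQc hsgn hm
  refine ⟨S.image Prod.swap, ?_, by rwa [Finset.card_image_of_injective _ Prod.swap_injective]⟩
  intro a ha
  obtain ⟨b, hb, rfl⟩ := Finset.mem_image.mp ha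
  obtain ⟨hbox, hdist⟩ := hS b hb
  exact ⟨⟨hbox.2, hbox.1⟩, hdist⟩

/-- `ℓ¹` bookkeeping for the two anchors: `‖P‖₁ ≤ Rn`, `‖Q‖₁ ≤ Rn` and `‖P - Q‖₁ ≥ 2 Rn` force opposite weak signs
in each coordinate, and one of `|P.2 - Q.2| ≤ Rn`, `|P.1 - Q.1| ≤ Rn`. -/
theorem anchors_l1 {p₁ p₂ q₁ q₂ : ℤ} {Rn : ℕ} (hP : |p₁| + |p₂| ≤ Rn) (hQ : |q₁| + |q₂| ≤ Rn)
    (hPQ : 2 * (Rn : ℤ) ≤ |p₁ - q₁| + |p₂ - q₂|) :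
    ((p₂ ≤ 0 ∧ 0 ≤ q₂ ∨ q₂ ≤ 0 ∧ 0 ≤ p₂) ∧ |p₂ - q₂| ≤ Rn) ∨
      ((p₁ ≤ 0 ∧ 0 ≤ q₁ ∨ q₁ ≤ 0 ∧ 0 ≤ p₁) ∧ |p₁ - q₁| ≤ Rn) := by
  have h1 := abs_cases p₁
  have h2 := abs_cases p₂
  have h3 := abs_cases q₁
  have h4 := abs_cases q₂
  have h5 := abs_cases (p₁ - q₁)
  have h6 := abs_cases (p₂ - q₂)
  omega

/-- **Core of the stub** for an abstract graph `Γ` on `ℕ` with a chart `ψ` of radius `Rn ≥ 1` with tracking, centred at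
`x`: if `dist x c = Rn + 1` and `x` lies on a geodesic from `c` to a vertex `p` with `dist c p ≥ 2 Rn + 1`, then at
least `Rn - 1` box points are sent to vertices at distance exactly `Rn + 1` from `c` (anchors by tracking the two
geodesics for `Rn` steps, `anchors_l1`, then `rows_core` or `cols_core`). -/
theorem sphere_core {Γ : SimpleGraph ℕ} {Rn : ℕ} {ψ : ℤ × ℤ → ℕ} (hRn : 1 ≤ Rn)
    (hC : IsChart Γ Rn ψ) (hT : ChartTracking Γ Rn ψ) {x c p : ℕ} (hx : ψ (0, 0) = x)
    (hd : Γ.dist x c = Rn + 1) (hsplit : Γ.dist c p = Γ.dist c x + Γ.dist x p)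
    (hfar : 2 * Rn + 1 ≤ Γ.dist c p) :
    ∃ S : Finset (ℤ × ℤ), (∀ a ∈ S, InBox Rn a ∧ Γ.dist (ψ a) c = Rn + 1) ∧ Rn - 1 ≤ S.card := by
  -- near anchor: the `Rn`-th vertex of a geodesic from `x` to `c`
  have hxc : Γ.Reachable x c := SimpleGraph.Reachable.of_dist_ne_zero (by omega)
  obtain ⟨W₁, hW₁⟩ := hxc.exists_walk_length_eq_dist
  obtain ⟨P₁, -, -, hP₁⟩ := hT x c W₁ hx.symm
  obtain ⟨hPv, hPn⟩ := hP₁ Rn (by omega) le_rfl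
  have hPc : Γ.Adj (ψ (P₁ Rn)) c := by
    have h := W₁.adj_getVert_succ (i := Rn) (by omega)
    rwa [hPv, W₁.getVert_of_length_le (by omega)] at h
  have hPc1 : Γ.dist (ψ (P₁ Rn)) c = 1 := SimpleGraph.dist_eq_one_iff_adj.mpr hPc
  -- far anchor: the `Rn`-th vertex of a geodesic from `x` to `p`
  have hcx : Γ.dist c x = Rn + 1 := by rw [SimpleGraph.dist_comm, hd]
  have hxp : Γ.Reachable x p := SimpleGraph.Reachable.of_dist_ne_zero (by omega)
  obtain ⟨W₂, hW₂⟩ := hxp.exists_walk_length_eq_dist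
  obtain ⟨P₂, -, -, hP₂⟩ := hT x p W₂ hx.symm
  obtain ⟨hQv, hQn⟩ := hP₂ Rn (by omega) le_rfl
  have hQp : Γ.Reachable (ψ (P₂ Rn)) p ∧ Γ.dist (ψ (P₂ Rn)) p ≤ Γ.dist x p - Rn := by
    have h := SimpleGraph.dist_le (W₂.drop Rn)
    have hr := (W₂.drop Rn).reachable
    rw [W₂.drop_length] at h
    rw [hQv] at h hr
    rw [hW₂] at h
    exact ⟨hr, h⟩
  have hQc : 2 * Rn + 1 ≤ Γ.dist (ψ (P₂ Rn)) c := by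
    have htri := hQp.1.dist_triangle_right c
    have e : Γ.dist c (ψ (P₂ Rn)) = Γ.dist (ψ (P₂ Rn)) c := SimpleGraph.dist_comm
    have h2 := hQp.2
    omega
  -- the anchors are `2 Rn` apart in the chart
  have hbP : InBox Rn (P₁ Rn) :=
    ⟨by have := abs_nonneg (P₁ Rn).2; omega, by have := abs_nonneg (P₁ Rn).1; omega⟩
  have hbQ : InBox Rn (P₂ Rn) :=
    ⟨by have := abs_nonneg (P₂ Rn).2; omega, by have := abs_nonneg (P₂ Rn).1; omega⟩
  have hPQ : 2 * (Rn : ℤ) ≤ |(P₁ Rn).1 - (P₂ Rn).1| + |(P₁ Rn).2 - (P₂ Rn).2| := by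
    obtain ⟨hr, hdPQ⟩ := chart_dist hC.2.1 (|(P₂ Rn).1 - (P₁ Rn).1| + |(P₂ Rn).2 - (P₁ Rn).2|).toNat
      (P₂ Rn) (P₁ Rn) hbQ hbP (Int.self_le_toNat _)
    have htri := hr.dist_triangle_left c
    rw [abs_sub_comm (P₂ Rn).1, abs_sub_comm (P₂ Rn).2] at hdPQ
    have := abs_nonneg ((P₁ Rn).1 - (P₂ Rn).1)
    have := abs_nonneg ((P₁ Rn).2 - (P₂ Rn).2)
    omega
  rcases anchors_l1 hPn hQn hPQ with ⟨hsgn, hm⟩ | ⟨hsgn, hm⟩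
  · exact rows_core hC.2.1 c hRn (P₁ Rn) (P₂ Rn) hPn hQn hPc1.le hQc hsgn hm
  · exact cols_core hC.2.1 c hRn (P₁ Rn) (P₂ Rn) hPn hQn hPc1.le hQc hsgn hm

end StubSphereLarge

/-- **Registered stub SPHERE LARGE** of the skeleton `Lines/no_admissible_complex.lean` v3: for `k ≥ 16`, in an
admissible complex whose flat vertices carry charts with tracking (`IsChart`, `ChartTracking` of `cV x` at radius
`k/4`), the first flat shell around the cone `c` of a cone frame `(c, x)` has at least `k/4 - 1` elements. The chart
at `x` and the two geodesics of the frame are fed to `StubSphereLarge.sphere_core`, whose `≥ k/4 - 1` distinct box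
points are sent injectively (`IsChart`, injectivity on the box) into the shell (`Adm.chart_mem`). -/
theorem stub_sphereLarge :
    ∀ (k j : ℕ) (V E Q : Finset ℕ) (σ τ : ℕ → ℕ) (bd : ℕ → Fin 4 → ℕ × Bool) (cV : ℕ → ℤ × ℤ → ℕ) (cE : ℕ → ℤ × ℤ → Fin 2 → ℕ × Bool), 16 ≤ k → Adm k j V E Q σ τ bd cV cE → (∀ x : ℕ, IsFlatAt k V E σ τ x → IsChart (graphOf E σ τ) ((k : ℤ) / 4) (cV x) ∧ ChartTracking (graphOf E σ τ) ((k : ℤ) / 4) (cV x)) → ∀ c x : ℕ, ConeFrame k V E σ τ c x → k / 4 ≤ sphereCard k V E σ τ c + 1 := by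
  intro k j V E Q σ τ bd cV cE hk hA hch c x hfr
  obtain ⟨hc, hx, hd, p, hp, hsplit⟩ := hfr
  obtain ⟨hC, hT⟩ := hch x hx
  have hR : ((k : ℤ) / 4) = ((k / 4 : ℕ) : ℤ) := by omega
  rw [hR] at hC hT
  have hfar : 2 * (k / 4) + 1 ≤ (graphOf E σ τ).dist c p := by
    have h := hp.2 c hc
    rw [SimpleGraph.dist_comm] at h
    omega
  obtain ⟨S, hS, hcard⟩ :=
    StubSphereLarge.sphere_core (by omega) hC hT (hA.chart_center hx) hd hsplit hfar
  have hle : S.card ≤ (V.filter fun v => (graphOf E σ τ).dist v c = k / 4 + 1).card :=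
    Finset.card_le_card_of_injOn (cV x)
      (fun a ha => by
        obtain ⟨hbox, hdist⟩ := hS a (Finset.mem_coe.mp ha)
        rw [Finset.coe_filter]
        exact ⟨hA.chart_mem hx a (by rw [hR]; exact hbox), hdist⟩)
      (fun a ha b hb h => hC.1 (hS a (Finset.mem_coe.mp ha)).1 (hS b (Finset.mem_coe.mp hb)).1 h)
  unfold sphereCard
  omega

end Summit.QuantumFields.YangMills.Cruxes.HyperbolicToTorus.NoAdmissibleComplex
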